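import Summits.Ventures.YMGap.RobustBall.SU2TwoStapleHaar
import HarnessLib

/-!
# Venture YMGap, track ROBUST-BALL — `SU(N)` HAAR ALGEBRA OF TWO STAPLES, EVERY `N ≥ 2`:
# `∫ (Re tr(Ua) + Re tr(Ub))² dU = 2 V_N (1 + Re tr(b⁻¹a)/N)`, `V_N = ∫ (Re tr U)² dU`

HONEST FRAMING. WHAT THIS IS: a venture file (cell `pub-ymgap`, track Y2 ROBUST-BALL, seat ds-3, theorems only; the every-`N` form of step 4
of the non-degeneracy «C-CLT-ND» of the plaquette central limit theorem). Haar measure on `SU(N)`, fundamental representation: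
* `integral_trace_mul_mul_conj_trace_suN` — Schur: `∫ tr(Ug) · conj(tr U) dU = tr(g)/N` (every `N`; `∫ U_{ai} conj(U_{bk}) = δ_{ab}δ_{ik}/N`,
  `HaarSecondMoments.integral_entry_mul_conj_entry_suN`);
* `integral_trace_mul_mul_trace_suN_eq_zero` — centre twist: `∫ tr(Ug) · tr U dU = 0` for `N ≥ 3` (`U ↦ e^{2πi/N} U` multiplies the
  integrand by `ζ²`, `ζ² ≠ 1`); for `N = 2` it is `tr(g)/2` (the trace is real);
* ★ `integral_trace_mul_re_mul_trace_re_suN` — `∫ Re tr(Ug) · Re tr(U) dU = V_N · Re tr(g)/N` for every `N ≥ 2`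
  (`V_N = charVariance = 1` for `N = 2`, `1/2` for `N ≥ 3`: `HaarSecondMoments.charVariance_su2/suN`);
* ★★ `integral_two_staple_sq_suN` — `∫ (Re tr(Ua) + Re tr(Ub))² dU = 2 V_N (1 + Re tr(b⁻¹a)/N)`, `integral_two_staple_suN = 0`,
  `variance_two_staple_suN`: the Haar-fibre variance of the two equally oriented plaquettes through a link is `2V_N(1 + W_{1×2}/N) ≥ 0`.
WHAT THIS IS NOT: nothing lattice-specific; the `N = 2` closed forms are `SU2TwoStapleHaar`.
References: M. Creutz, Quarks, Gluons and Lattices (1983) (8.20); folklore.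
-/

noncomputable section

open MeasureTheory Complex ComplexConjugate Finset
open Literature.MathematicalPhysics.QuantumLattice Literature.MathematicalPhysics.QuantumFieldTheory

namespace Summit.Ventures.YMGap.RobustBall

namespace SUNTwoStaple

variable {N : ℕ}

/-! ### Continuity and integrability on `SU(N)` -/

/-- Continuous real functions on `SU(N)` are Haar integrable. [folklore] -/
theorem integrable_of_continuous {F : Matrix.specialUnitaryGroup (Fin N) ℂ → ℝ} (hF : Continuous F) :
    Integrable F (haarProbability (Matrix.specialUnitaryGroup (Fin N) ℂ)) :=
  hF.integrable_of_hasCompactSupport (HasCompactSupport.of_compactSpace _)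

/-- `U ↦ Re tr(U g)` is continuous on `SU(N)`. [folklore] -/
theorem continuous_trace_re_mul (g : Matrix.specialUnitaryGroup (Fin N) ℂ) :
    Continuous fun U : Matrix.specialUnitaryGroup (Fin N) ℂ => ((U * g : Matrix.specialUnitaryGroup (Fin N) ℂ) : Matrix (Fin N) (Fin N) ℂ).trace.re :=
  Complex.continuous_re.comp ((continuous_subtype_val.comp (continuous_id.mul continuous_const)).matrix_trace)

/-- Right invariance: `∫ F(Re tr(U g)) dU = ∫ F(Re tr U) dU`. [folklore] -/
theorem integral_comp_trace_re_mul_right (g : Matrix.specialUnitaryGroup (Fin N) ℂ) (F : ℝ → ℝ) :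
    ∫ U, F ((U * g : Matrix.specialUnitaryGroup (Fin N) ℂ) : Matrix (Fin N) (Fin N) ℂ).trace.re
        ∂haarProbability (Matrix.specialUnitaryGroup (Fin N) ℂ) =
      ∫ U, F ((U : Matrix (Fin N) (Fin N) ℂ).trace).re ∂haarProbability (Matrix.specialUnitaryGroup (Fin N) ℂ) :=
  integral_mul_right_eq_self (μ := haarProbability (Matrix.specialUnitaryGroup (Fin N) ℂ))
    (fun U : Matrix.specialUnitaryGroup (Fin N) ℂ => F ((U : Matrix (Fin N) (Fin N) ℂ).trace).re) g

/-- `∫ Re tr(U) dU = 0` on `SU(N)`, `N ≥ 2`. [folklore] -/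
theorem integral_trace_re_suN (hN : 2 ≤ N) :
    ∫ U, ((U : Matrix (Fin N) (Fin N) ℂ).trace).re ∂haarProbability (Matrix.specialUnitaryGroup (Fin N) ℂ) = 0 := by
  have h := PlaquetteLowerBound.integral_reTr_eq_zero (fundamentalRep (Fin N)) (TorusAreaLaw.isSpecialUnitaryModel_fundamentalRep N) hN
  simpa only [PlaquetteLowerBound.reTr, fundamentalRep_apply] using h

/-- `∫ (Re tr U)² dU = V_N = charVariance (fundamentalRep (Fin N))`. [folklore] -/
theorem integral_trace_re_sq_suN :
    ∫ U, ((U : Matrix (Fin N) (Fin N) ℂ).trace).re ^ 2 ∂haarProbability (Matrix.specialUnitaryGroup (Fin N) ℂ) =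
      PlaquetteLowerBound.charVariance (fundamentalRep (Fin N)) := by
  simp only [PlaquetteLowerBound.charVariance, PlaquetteLowerBound.reTr, fundamentalRep_apply]

/-! ### Schur: `∫ tr(Ug) conj(tr U) dU = tr(g)/N` -/

/-- **Schur cross moment, complex form**: `∫ tr(Ug) · conj(tr U) dU = tr(g)/N` on `SU(N)` (both sides vanish for `N = 0`). [folklore] -/
theorem integral_trace_mul_mul_conj_trace_suN (g : Matrix.specialUnitaryGroup (Fin N) ℂ) :
    ∫ U, ((U : Matrix (Fin N) (Fin N) ℂ) * (g : Matrix (Fin N) (Fin N) ℂ)).trace * conj ((U : Matrix (Fin N) (Fin N) ℂ).trace)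
        ∂haarProbability (Matrix.specialUnitaryGroup (Fin N) ℂ) = (g : Matrix (Fin N) (Fin N) ℂ).trace / N := by
  have hexp : ∀ U : Matrix.specialUnitaryGroup (Fin N) ℂ,
      ((U : Matrix (Fin N) (Fin N) ℂ) * (g : Matrix (Fin N) (Fin N) ℂ)).trace * conj ((U : Matrix (Fin N) (Fin N) ℂ).trace) =
        ∑ c, ∑ a, ∑ i, (g : Matrix (Fin N) (Fin N) ℂ) i a * ((U : Matrix (Fin N) (Fin N) ℂ) a i * conj ((U : Matrix (Fin N) (Fin N) ℂ) c c)) := by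
    intro U
    simp only [Matrix.trace, Matrix.diag_apply, Matrix.mul_apply, map_sum, Finset.sum_mul, Finset.mul_sum]
    exact Finset.sum_congr rfl fun c _ => Finset.sum_congr rfl fun a _ => Finset.sum_congr rfl fun i _ => by ring
  simp_rw [hexp]
  have hint : ∀ a i b k : Fin N, Integrable (fun U : Matrix.specialUnitaryGroup (Fin N) ℂ =>
      (U : Matrix (Fin N) (Fin N) ℂ) a i * conj ((U : Matrix (Fin N) (Fin N) ℂ) b k)) (haarProbability (Matrix.specialUnitaryGroup (Fin N) ℂ)) :=
    fun a i b k => by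
      simpa only [fundamentalRep_apply] using
        HaarSecondMoments.integrable_entry_mul_conj_entry (fundamentalRep (Fin N)) (continuous_fundamentalRep (Fin N)) a i b k
  rw [integral_finsetSum _ fun c _ => integrable_finsetSum _ fun a _ => integrable_finsetSum _ fun i _ => (hint a i c c).const_mul _]
  have hin : ∀ c : Fin N, ∫ U, ∑ a, ∑ i, (g : Matrix (Fin N) (Fin N) ℂ) i a *
      ((U : Matrix (Fin N) (Fin N) ℂ) a i * conj ((U : Matrix (Fin N) (Fin N) ℂ) c c)) ∂haarProbability (Matrix.specialUnitaryGroup (Fin N) ℂ) =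
      (g : Matrix (Fin N) (Fin N) ℂ) c c * (N : ℂ)⁻¹ := by
    intro c
    rw [integral_finsetSum _ fun a _ => integrable_finsetSum _ fun i _ => (hint a i c c).const_mul _]
    have hin2 : ∀ a : Fin N, ∫ U, ∑ i, (g : Matrix (Fin N) (Fin N) ℂ) i a *
        ((U : Matrix (Fin N) (Fin N) ℂ) a i * conj ((U : Matrix (Fin N) (Fin N) ℂ) c c)) ∂haarProbability (Matrix.specialUnitaryGroup (Fin N) ℂ) =
        if a = c then (g : Matrix (Fin N) (Fin N) ℂ) c c * (N : ℂ)⁻¹ else 0 := by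
      intro a
      rw [integral_finsetSum _ fun i _ => (hint a i c c).const_mul _]
      simp_rw [integral_const_mul, HaarSecondMoments.integral_entry_mul_conj_entry_suN]
      by_cases hac : a = c
      · subst hac
        rw [if_pos rfl, Finset.sum_eq_single a (fun i _ hi => by rw [if_neg (fun h => hi h.2), mul_zero])
          (fun h => absurd (Finset.mem_univ a) h), if_pos ⟨rfl, rfl⟩]
      · rw [if_neg hac]
        exact Finset.sum_eq_zero fun i _ => by rw [if_neg (fun h => hac h.1), mul_zero]
    simp_rw [hin2]
    rw [Finset.sum_ite_eq' Finset.univ c, if_pos (Finset.mem_univ c)]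
  simp_rw [hin]
  rw [← Finset.sum_mul, div_eq_mul_inv]
  rfl

/-! ### Centre twist: `∫ tr(Ug) tr(U) dU = 0` for `N ≥ 3` -/

/-- **Centre twist**: `∫ tr(Ug) · tr(U) dU = 0` on `SU(N)` for `N ≥ 3` (left-translate by `ζ·1`, `ζ = e^{2πi/N}`, `ζ² ≠ 1`). [folklore] -/
theorem integral_trace_mul_mul_trace_suN_eq_zero (hN : 3 ≤ N) (g : Matrix.specialUnitaryGroup (Fin N) ℂ) :
    ∫ U, ((U : Matrix (Fin N) (Fin N) ℂ) * (g : Matrix (Fin N) (Fin N) ℂ)).trace * (U : Matrix (Fin N) (Fin N) ℂ).trace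
        ∂haarProbability (Matrix.specialUnitaryGroup (Fin N) ℂ) = 0 := by
  set ζ : ℂ := Complex.exp (2 * Real.pi * Complex.I / N) with hζdef
  have hN0 : N ≠ 0 := by omega
  have hprim : IsPrimitiveRoot ζ N := Complex.isPrimitiveRoot_exp N hN0
  have hζ2 : ζ ^ 2 ≠ 1 := fun h => by
    have := Nat.le_of_dvd two_pos ((hprim.pow_eq_one_iff_dvd 2).mp h); omega
  have hmem : ζ • (1 : Matrix (Fin N) (Fin N) ℂ) ∈ Matrix.specialUnitaryGroup (Fin N) ℂ := by
    rw [hζdef]; exact HaarSecondMoments.smul_one_mem (N := N) hN0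
  have h := HaarSecondMoments.integral_comp_mul_left (fundamentalRep (Fin N)) (TorusAreaLaw.isSpecialUnitaryModel_fundamentalRep N) hmem
    (fun M => (M * (g : Matrix (Fin N) (Fin N) ℂ)).trace * M.trace)
  simp only [fundamentalRep_apply] at h
  have ht : ∀ M : Matrix (Fin N) (Fin N) ℂ, (ζ • (1 : Matrix (Fin N) (Fin N) ℂ) * M * (g : Matrix (Fin N) (Fin N) ℂ)).trace *
      (ζ • (1 : Matrix (Fin N) (Fin N) ℂ) * M).trace = ζ ^ 2 * ((M * (g : Matrix (Fin N) (Fin N) ℂ)).trace * M.trace) := fun M => by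
    rw [smul_mul_assoc, one_mul, smul_mul_assoc, Matrix.trace_smul, Matrix.trace_smul, smul_eq_mul, smul_eq_mul]; ring
  simp only [ht] at h
  rw [integral_const_mul] at h
  set J : ℂ := ∫ U, ((U : Matrix (Fin N) (Fin N) ℂ) * (g : Matrix (Fin N) (Fin N) ℂ)).trace * (U : Matrix (Fin N) (Fin N) ℂ).trace
    ∂haarProbability (Matrix.specialUnitaryGroup (Fin N) ℂ)
  have h2 : (ζ ^ 2 - 1) * J = 0 := by rw [sub_mul, one_mul, h, sub_self]
  rcases mul_eq_zero.mp h2 with h' | h'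
  · exact absurd (sub_eq_zero.mp h') hζ2
  · exact h'

/-- **`N = 2`**: `∫ tr(Ug) · tr(U) dU = tr(g)/2` (the trace of `SU(2)` is real, so this is the Schur cross moment). [folklore] -/
theorem integral_trace_mul_mul_trace_su2 (g : Matrix.specialUnitaryGroup (Fin 2) ℂ) :
    ∫ U, ((U : Matrix (Fin 2) (Fin 2) ℂ) * (g : Matrix (Fin 2) (Fin 2) ℂ)).trace * (U : Matrix (Fin 2) (Fin 2) ℂ).trace
        ∂haarProbability (Matrix.specialUnitaryGroup (Fin 2) ℂ) = (g : Matrix (Fin 2) (Fin 2) ℂ).trace / 2 := by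
  have hre : ∀ U : Matrix.specialUnitaryGroup (Fin 2) ℂ, (U : Matrix (Fin 2) (Fin 2) ℂ).trace = conj ((U : Matrix (Fin 2) (Fin 2) ℂ).trace) :=
    fun U => (Complex.conj_eq_iff_im.2 (NarrowWell.trace_im_eq_zero U)).symm
  have h := SU2TwoStaple.integral_trace_mul_mul_conj_trace_su2 g
  refine Eq.trans (integral_congr_ae (Filter.Eventually.of_forall fun U => ?_)) h
  simp only
  rw [← hre U]

/-! ### ★ The real cross moment for every `N ≥ 2` -/

/-- `Re z · Re w = (Re(z · conj w) + Re(z · w))/2` (polarisation). [folklore] -/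
theorem re_mul_re_eq (z w : ℂ) : z.re * w.re = ((z * conj w).re + (z * w).re) / 2 := by
  simp only [Complex.mul_re, Complex.conj_re, Complex.conj_im]
  ring

/-- ★ **Schur cross moment, real form, every `N ≥ 2`**: `∫ Re tr(Ug) · Re tr(U) dU = V_N · Re tr(g) / N`,
`V_N = charVariance (fundamentalRep (Fin N))` (`= 1` for `N = 2`, `= 1/2` for `N ≥ 3`). [folklore] -/
theorem integral_trace_mul_re_mul_trace_re_suN (hN : 2 ≤ N) (g : Matrix.specialUnitaryGroup (Fin N) ℂ) :
    ∫ U, ((U * g : Matrix.specialUnitaryGroup (Fin N) ℂ) : Matrix (Fin N) (Fin N) ℂ).trace.re * ((U : Matrix (Fin N) (Fin N) ℂ).trace).re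
        ∂haarProbability (Matrix.specialUnitaryGroup (Fin N) ℂ) =
      PlaquetteLowerBound.charVariance (fundamentalRep (Fin N)) * ((g : Matrix (Fin N) (Fin N) ℂ).trace).re / N := by
  have hc : ∀ U : Matrix.specialUnitaryGroup (Fin N) ℂ, ((U * g : Matrix.specialUnitaryGroup (Fin N) ℂ) : Matrix (Fin N) (Fin N) ℂ) =
      (U : Matrix (Fin N) (Fin N) ℂ) * (g : Matrix (Fin N) (Fin N) ℂ) := fun U => rfl
  simp_rw [hc, re_mul_re_eq]
  have hcu : Continuous fun U : Matrix.specialUnitaryGroup (Fin N) ℂ => ((U : Matrix (Fin N) (Fin N) ℂ) * (g : Matrix (Fin N) (Fin N) ℂ)).trace :=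
    (continuous_subtype_val.mul continuous_const).matrix_trace
  have hct : Continuous fun U : Matrix.specialUnitaryGroup (Fin N) ℂ => (U : Matrix (Fin N) (Fin N) ℂ).trace := continuous_subtype_val.matrix_trace
  have hi1 : Integrable (fun U : Matrix.specialUnitaryGroup (Fin N) ℂ =>
      ((U : Matrix (Fin N) (Fin N) ℂ) * (g : Matrix (Fin N) (Fin N) ℂ)).trace * conj ((U : Matrix (Fin N) (Fin N) ℂ).trace))
      (haarProbability (Matrix.specialUnitaryGroup (Fin N) ℂ)) :=
    (hcu.mul (Complex.continuous_conj.comp hct)).integrable_of_hasCompactSupport (HasCompactSupport.of_compactSpace _)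
  have hi2 : Integrable (fun U : Matrix.specialUnitaryGroup (Fin N) ℂ =>
      ((U : Matrix (Fin N) (Fin N) ℂ) * (g : Matrix (Fin N) (Fin N) ℂ)).trace * (U : Matrix (Fin N) (Fin N) ℂ).trace)
      (haarProbability (Matrix.specialUnitaryGroup (Fin N) ℂ)) :=
    (hcu.mul hct).integrable_of_hasCompactSupport (HasCompactSupport.of_compactSpace _)
  have e1 := integral_re hi1
  have e2 := integral_re hi2
  simp only [RCLike.re_to_complex] at e1 e2
  have hi1r : Integrable (fun U : Matrix.specialUnitaryGroup (Fin N) ℂ =>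
      (((U : Matrix (Fin N) (Fin N) ℂ) * (g : Matrix (Fin N) (Fin N) ℂ)).trace * conj ((U : Matrix (Fin N) (Fin N) ℂ).trace)).re)
      (haarProbability (Matrix.specialUnitaryGroup (Fin N) ℂ)) := hi1.re
  have hi2r : Integrable (fun U : Matrix.specialUnitaryGroup (Fin N) ℂ =>
      (((U : Matrix (Fin N) (Fin N) ℂ) * (g : Matrix (Fin N) (Fin N) ℂ)).trace * (U : Matrix (Fin N) (Fin N) ℂ).trace).re)
      (haarProbability (Matrix.specialUnitaryGroup (Fin N) ℂ)) := hi2.re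
  rw [integral_div, integral_add hi1r hi2r, e1, e2, integral_trace_mul_mul_conj_trace_suN g]
  have hN0 : (N : ℂ) ≠ 0 := by exact_mod_cast (show N ≠ 0 by omega)
  rcases Nat.lt_or_ge N 3 with h3 | h3
  · obtain rfl : N = 2 := by omega
    rw [integral_trace_mul_mul_trace_su2 g, HaarSecondMoments.charVariance_su2]
    simp only [Nat.cast_ofNat, Complex.div_ofNat_re]
    ring
  · rw [integral_trace_mul_mul_trace_suN_eq_zero h3 g, HaarSecondMoments.charVariance_suN h3, Complex.zero_re, add_zero, Complex.div_natCast_re]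
    ring

/-! ### ★★ Two staples, every `N ≥ 2` -/

/-- ★★ **TWO-STAPLE SECOND MOMENT, every `N ≥ 2`**: `∫ (Re tr(Ua) + Re tr(Ub))² dU = 2 V_N (1 + Re tr(b⁻¹a)/N)` on `SU(N)`
(right-translate by `b⁻¹`, expand: `V_N + V_N + 2 V_N Re tr(b⁻¹a)/N`). [folklore] -/
theorem integral_two_staple_sq_suN (hN : 2 ≤ N) (a b : Matrix.specialUnitaryGroup (Fin N) ℂ) :
    ∫ U, (((U * a : Matrix.specialUnitaryGroup (Fin N) ℂ) : Matrix (Fin N) (Fin N) ℂ).trace.re +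
        ((U * b : Matrix.specialUnitaryGroup (Fin N) ℂ) : Matrix (Fin N) (Fin N) ℂ).trace.re) ^ 2
        ∂haarProbability (Matrix.specialUnitaryGroup (Fin N) ℂ) =
      2 * PlaquetteLowerBound.charVariance (fundamentalRep (Fin N)) *
        (1 + ((b⁻¹ * a : Matrix.specialUnitaryGroup (Fin N) ℂ) : Matrix (Fin N) (Fin N) ℂ).trace.re / N) := by
  set g : Matrix.specialUnitaryGroup (Fin N) ℂ := b⁻¹ * a with hg
  have hsub := integral_mul_right_eq_self (μ := haarProbability (Matrix.specialUnitaryGroup (Fin N) ℂ))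
    (fun U : Matrix.specialUnitaryGroup (Fin N) ℂ => (((U * a : Matrix.specialUnitaryGroup (Fin N) ℂ) : Matrix (Fin N) (Fin N) ℂ).trace.re +
        ((U * b : Matrix.specialUnitaryGroup (Fin N) ℂ) : Matrix (Fin N) (Fin N) ℂ).trace.re) ^ 2) b⁻¹
  simp only [inv_mul_cancel_right] at hsub
  rw [← hsub]
  have hrw : ∀ U : Matrix.specialUnitaryGroup (Fin N) ℂ, U * b⁻¹ * a = U * g := fun U => by rw [hg, mul_assoc]
  simp_rw [hrw]
  have hexp : ∀ U : Matrix.specialUnitaryGroup (Fin N) ℂ,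
      (((U * g : Matrix.specialUnitaryGroup (Fin N) ℂ) : Matrix (Fin N) (Fin N) ℂ).trace.re + ((U : Matrix (Fin N) (Fin N) ℂ).trace).re) ^ 2 =
        ((U * g : Matrix.specialUnitaryGroup (Fin N) ℂ) : Matrix (Fin N) (Fin N) ℂ).trace.re ^ 2 + ((U : Matrix (Fin N) (Fin N) ℂ).trace).re ^ 2 +
          2 * (((U * g : Matrix.specialUnitaryGroup (Fin N) ℂ) : Matrix (Fin N) (Fin N) ℂ).trace.re * ((U : Matrix (Fin N) (Fin N) ℂ).trace).re) :=
    fun U => by ring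
  simp_rw [hexp]
  have hc1 : Continuous fun U : Matrix.specialUnitaryGroup (Fin N) ℂ =>
      ((U * g : Matrix.specialUnitaryGroup (Fin N) ℂ) : Matrix (Fin N) (Fin N) ℂ).trace.re := continuous_trace_re_mul g
  have hc0 : Continuous fun U : Matrix.specialUnitaryGroup (Fin N) ℂ => ((U : Matrix (Fin N) (Fin N) ℂ).trace).re :=
    Complex.continuous_re.comp continuous_subtype_val.matrix_trace
  have i1 : Integrable (fun U : Matrix.specialUnitaryGroup (Fin N) ℂ =>
      ((U * g : Matrix.specialUnitaryGroup (Fin N) ℂ) : Matrix (Fin N) (Fin N) ℂ).trace.re ^ 2) (haarProbability _) :=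
    integrable_of_continuous (hc1.pow 2)
  have i2 : Integrable (fun U : Matrix.specialUnitaryGroup (Fin N) ℂ => ((U : Matrix (Fin N) (Fin N) ℂ).trace).re ^ 2) (haarProbability _) :=
    integrable_of_continuous (hc0.pow 2)
  have i3 : Integrable (fun U : Matrix.specialUnitaryGroup (Fin N) ℂ =>
      2 * (((U * g : Matrix.specialUnitaryGroup (Fin N) ℂ) : Matrix (Fin N) (Fin N) ℂ).trace.re * ((U : Matrix (Fin N) (Fin N) ℂ).trace).re))
      (haarProbability _) :=
    integrable_of_continuous (continuous_const.mul (hc1.mul hc0))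
  have i12 : Integrable (fun U : Matrix.specialUnitaryGroup (Fin N) ℂ =>
      ((U * g : Matrix.specialUnitaryGroup (Fin N) ℂ) : Matrix (Fin N) (Fin N) ℂ).trace.re ^ 2 + ((U : Matrix (Fin N) (Fin N) ℂ).trace).re ^ 2)
      (haarProbability _) := i1.add i2
  rw [integral_add i12 i3, integral_add i1 i2, integral_const_mul, integral_trace_mul_re_mul_trace_re_suN hN,
    integral_comp_trace_re_mul_right g (fun r => r ^ 2), integral_trace_re_sq_suN]
  ring

/-- **Two-staple first moment**: `∫ (Re tr(Ua) + Re tr(Ub)) dU = 0` on `SU(N)`, `N ≥ 2`. [folklore] -/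
theorem integral_two_staple_suN (hN : 2 ≤ N) (a b : Matrix.specialUnitaryGroup (Fin N) ℂ) :
    ∫ U, (((U * a : Matrix.specialUnitaryGroup (Fin N) ℂ) : Matrix (Fin N) (Fin N) ℂ).trace.re +
        ((U * b : Matrix.specialUnitaryGroup (Fin N) ℂ) : Matrix (Fin N) (Fin N) ℂ).trace.re)
        ∂haarProbability (Matrix.specialUnitaryGroup (Fin N) ℂ) = 0 := by
  rw [integral_add (integrable_of_continuous (continuous_trace_re_mul a)) (integrable_of_continuous (continuous_trace_re_mul b)),
    integral_comp_trace_re_mul_right a (fun r => r), integral_comp_trace_re_mul_right b (fun r => r), integral_trace_re_suN hN, add_zero]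

/-- ★★ **TWO-STAPLE HAAR VARIANCE, every `N ≥ 2`**: `∫ (F − ∫F)² dU = 2 V_N (1 + Re tr(b⁻¹a)/N)` for `F(U) = Re tr(Ua) + Re tr(Ub)`. [folklore] -/
theorem variance_two_staple_suN (hN : 2 ≤ N) (a b : Matrix.specialUnitaryGroup (Fin N) ℂ) :
    ∫ U, ((((U * a : Matrix.specialUnitaryGroup (Fin N) ℂ) : Matrix (Fin N) (Fin N) ℂ).trace.re +
        ((U * b : Matrix.specialUnitaryGroup (Fin N) ℂ) : Matrix (Fin N) (Fin N) ℂ).trace.re) -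
        ∫ U', (((U' * a : Matrix.specialUnitaryGroup (Fin N) ℂ) : Matrix (Fin N) (Fin N) ℂ).trace.re +
          ((U' * b : Matrix.specialUnitaryGroup (Fin N) ℂ) : Matrix (Fin N) (Fin N) ℂ).trace.re)
          ∂haarProbability (Matrix.specialUnitaryGroup (Fin N) ℂ)) ^ 2
        ∂haarProbability (Matrix.specialUnitaryGroup (Fin N) ℂ) =
      2 * PlaquetteLowerBound.charVariance (fundamentalRep (Fin N)) *
        (1 + ((b⁻¹ * a : Matrix.specialUnitaryGroup (Fin N) ℂ) : Matrix (Fin N) (Fin N) ℂ).trace.re / N) := by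
  simp_rw [integral_two_staple_suN hN a b, sub_zero]
  exact integral_two_staple_sq_suN hN a b

/-- **The two-staple variance is at least `2V_N(1 − |Re tr(b⁻¹a)|/N) ≥ 0`** (`|Re tr| ≤ N`, `V_N ≥ 1/2`). [folklore] -/
theorem two_staple_variance_nonneg (hN : 2 ≤ N) (g : Matrix.specialUnitaryGroup (Fin N) ℂ) :
    0 ≤ 2 * PlaquetteLowerBound.charVariance (fundamentalRep (Fin N)) * (1 + ((g : Matrix (Fin N) (Fin N) ℂ).trace).re / N) := by
  have hV := HaarSecondMoments.half_le_charVariance (fundamentalRep (Fin N)) (TorusAreaLaw.isSpecialUnitaryModel_fundamentalRep N) hN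
  have hN0 : (0 : ℝ) < N := by exact_mod_cast (show 0 < N by omega)
  have htr : |((g : Matrix (Fin N) (Fin N) ℂ).trace).re| ≤ N := by
    have h := PlaquetteLowerBound.abs_reTr_le (fundamentalRep (Fin N)) fundamentalRep_mem_unitaryGroup g
    simpa only [PlaquetteLowerBound.reTr, fundamentalRep_apply] using h
  have h1 : 0 ≤ 1 + ((g : Matrix (Fin N) (Fin N) ℂ).trace).re / N := by
    rw [abs_le] at htr
    have : -1 ≤ ((g : Matrix (Fin N) (Fin N) ℂ).trace).re / N := by rw [le_div_iff₀ hN0]; linarith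
    linarith
  positivity

end SUNTwoStaple

end Summit.Ventures.YMGap.RobustBall

end
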